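import Summits.HubbardSuperconductivity.HubbardSuperconductivity.Theorems.SoloBlindPlaquetteDefs
import HarnessLib

/-!
# Plaquette Mott floor — hole patterns on a four-cycle (Theorem 42, part 2/5)

Solo-blind programme `HubbardSuperconductivity`, generation 55 — the *plaquette Mott floor*
(Theorem 42, `SoloBlindPlaquetteMottFloor.plaquette_mott_floor`): for `U ≥ 16`, `L` even and every
`N`-particle `ψ`, `re ⟨ψ, H_U ψ⟩ ≥ -(4 N_h - (2 - √2)·max(0, 4 N_h - L²) + 64 L²/U) ‖ψ‖²`,
`N_h = L² - N`, sharpening the Mott floor `-(4 N_h + 64 L²/U)` of `SoloBlindMottFloor` by letting the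
AM–GM weight of a (sign-free) hole hop depend on the hole pattern of the black plaquette containing
the bond.

This file: the combinatorics of one plaquette.  A hole hop inside the plaquette links a diagonal with
an adjacent two-hole pattern, or two patterns with `cnt ≠ 2` (`hop_cases`), whence the admissibility
`1 ≤ 4·wt(hopA)·wt(hopB)` (`one_le_four_mul_wt_hop`); and the charge bound `wt E · mixed E ≤ Λ(cnt E)`
with `Λ = (0, 2, 2√2, 2, 0)` — `2√2` being the top eigenvalue of two hard-core bosons hopping on a
four-cycle — in the two linear majorants `Λ(h) ≤ 2h` and `Λ(h) ≤ (2√2-2) h + (4-2√2)`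
(`wt_mul_mixed_le_two_mul`, `wt_mul_mixed_le_line`).  All by exhaustion of the sixteen patterns.

[this work; folklore]
-/

noncomputable section

namespace Summit.HubbardSuperconductivity.HubbardSuperconductivity.Theorems.PlaquetteMottFloor

open Matrix Finset Literature.Probability.LatticeModels Literature.MathematicalPhysics.QuantumLattice
  Literature.MathematicalPhysics.QuantumLattice.EigenvalueContinuation
  Summit.HubbardSuperconductivity.HubbardSuperconductivity.Theorems.MottFloor
open scoped ComplexOrder ComplexConjugate

section Pattern

/-- Case analysis on the four Boolean entries of a pattern. [folklore] -/
theorem pattern_induction {P : (Fin 4 → Bool) → Prop} (h : ∀ a b c d : Bool, P ![a, b, c, d])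
    (E : Fin 4 → Bool) : P E := by
  have hE : E = ![E 0, E 1, E 2, E 3] := by
    ext j; fin_cases j <;> rfl
  rw [hE]; exact h _ _ _ _

/-- At most four corners are empty. [folklore] -/
theorem cnt_le_four (E : Fin 4 → Bool) : cnt E ≤ 4 :=
  (Finset.card_filter_le _ _).trans (by simp)

/-- **The pattern table**: `mixed = 0` for `0` or `4` holes, `mixed = 4` for `1` or `3` holes and for
an adjacent hole pair, `mixed = 8` for a diagonal hole pair. [this work; enumeration of 16 cases] -/
theorem pattern_cases (E : Fin 4 → Bool) :
    ((cnt E = 0 ∨ cnt E = 4) ∧ mixed E = 0) ∨ ((cnt E = 1 ∨ cnt E = 3) ∧ mixed E = 4) ∨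
      (cnt E = 2 ∧ IsDiag E ∧ mixed E = 8) ∨ (cnt E = 2 ∧ ¬ IsDiag E ∧ mixed E = 4) := by
  induction E using pattern_induction with
  | h a b c d => cases a <;> cases b <;> cases c <;> cases d <;> decide

/-- **The hop table**: the two sides of a hole hop inside the plaquette carry either a diagonal and
an adjacent two-hole pattern, or two patterns with hole number `≠ 2`. [this work; 128 cases] -/
theorem hop_cases (E : Fin 4 → Bool) (i : Fin 4 × Bool) :
    (cnt (hopA E i) = 2 ∧ cnt (hopB E i) = 2 ∧ (IsDiag (hopA E i) ↔ ¬ IsDiag (hopB E i))) ∨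
      (cnt (hopA E i) ≠ 2 ∧ cnt (hopB E i) ≠ 2) := by
  revert i
  induction E using pattern_induction with
  | h a b c d =>
    intro i
    obtain ⟨j, s⟩ := i
    fin_cases j <;> cases s <;> cases a <;> cases b <;> cases c <;> cases d <;> decide

/-- `√2 · √2 = 2`, `1 < √2 < 2`. [folklore] -/
private theorem sqrt_two_facts :
    Real.sqrt 2 * Real.sqrt 2 = 2 ∧ 1 < Real.sqrt 2 ∧ Real.sqrt 2 < 2 := by
  refine ⟨Real.mul_self_sqrt (by norm_num), ?_, ?_⟩
  · rw [show (1 : ℝ) = Real.sqrt 1 by simp]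
    exact Real.sqrt_lt_sqrt (by norm_num) (by norm_num)
  · rw [show (2 : ℝ) = Real.sqrt 4 by
      rw [show (4 : ℝ) = 2 ^ 2 by norm_num, Real.sqrt_sq (by norm_num : (0 : ℝ) ≤ 2)]]
    exact Real.sqrt_lt_sqrt (by norm_num) (by norm_num)

/-- The weights are positive. [folklore] -/
theorem wt_pos (E : Fin 4 → Bool) : 0 < wt E := by
  obtain ⟨_, h1, _⟩ := sqrt_two_facts
  unfold wt; split_ifs <;> linarith

/-- **AM–GM admissibility of the plaquette weights**: `1 ≤ 4 · wt(E_A) · wt(E_B)` for the two sides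
of every hole hop inside the plaquette. [this work] -/
theorem one_le_four_mul_wt_hop (E : Fin 4 → Bool) (i : Fin 4 × Bool) :
    1 ≤ 4 * wt (hopA E i) * wt (hopB E i) := by
  obtain ⟨h2, _, _⟩ := sqrt_two_facts
  rcases hop_cases E i with ⟨hA, hB, hd⟩ | ⟨hA, hB⟩
  · by_cases hdA : IsDiag (hopA E i)
    · have hdB : ¬ IsDiag (hopB E i) := hd.1 hdA
      simp only [wt, hA, hB, hdA, hdB, if_true, if_false]
      nlinarith [h2]
    · have hdB : IsDiag (hopB E i) := by
        by_contra h; exact hdA (hd.2 h)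
      simp only [wt, hA, hB, hdA, hdB, if_true, if_false]
      nlinarith [h2]
  · simp only [wt, hA, hB, if_false]
    norm_num

/-- **Charge bound, first majorant**: `wt E · mixed E ≤ 2 · cnt E`. [this work] -/
theorem wt_mul_mixed_le_two_mul (E : Fin 4 → Bool) :
    wt E * (mixed E : ℝ) ≤ 2 * (cnt E : ℝ) := by
  obtain ⟨h2, h1, h3⟩ := sqrt_two_facts
  rcases pattern_cases E with ⟨hc, hm⟩ | ⟨hc, hm⟩ | ⟨hc, hd, hm⟩ | ⟨hc, hd, hm⟩
  · rw [hm]; have := cnt_le_four E; simp only [Nat.cast_zero, mul_zero]; positivity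
  · have hc2 : cnt E ≠ 2 := by omega
    have hc1 : (1 : ℝ) ≤ cnt E := by rcases hc with h | h <;> rw [h] <;> norm_num
    simp only [wt, hc2, if_false, hm, Nat.cast_ofNat]
    linarith
  · simp only [wt, hc, hd, if_true, hm, Nat.cast_ofNat]
    linarith
  · simp only [wt, hc, hd, if_true, if_false, hm, Nat.cast_ofNat]
    linarith

/-- **Charge bound, second majorant**: `wt E · mixed E ≤ (2√2 - 2) · cnt E + (4 - 2√2)` — the chord
of `Λ = (0, 2, 2√2, 2, 0)` through `h = 1, 2`. [this work] -/
theorem wt_mul_mixed_le_line (E : Fin 4 → Bool) :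
    wt E * (mixed E : ℝ) ≤ (2 * Real.sqrt 2 - 2) * (cnt E : ℝ) + (4 - 2 * Real.sqrt 2) := by
  obtain ⟨h2, h1, h3⟩ := sqrt_two_facts
  rcases pattern_cases E with ⟨hc, hm⟩ | ⟨hc, hm⟩ | ⟨hc, hd, hm⟩ | ⟨hc, hd, hm⟩
  · rw [hm]
    have hc0 : (0 : ℝ) ≤ cnt E := by positivity
    simp only [Nat.cast_zero, mul_zero]
    nlinarith
  · have hc2 : cnt E ≠ 2 := by omega
    simp only [wt, hc2, if_false, hm, Nat.cast_ofNat]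
    rcases hc with h | h <;> rw [h] <;> push_cast <;> nlinarith
  · simp only [wt, hc, hd, if_true, hm, Nat.cast_ofNat]
    linarith
  · simp only [wt, hc, hd, if_true, if_false, hm, Nat.cast_ofNat]
    linarith

/-- Each corner is the source of two and the target of two local ordered bonds:
`Σ_i (g (src i) + g (dst i)) = 4 Σ_c g c`. [folklore] -/
theorem sum_src_add_dst (g : Fin 4 → ℝ) : ∑ i, (g (src i) + g (dst i)) = 4 * ∑ c, g c := by
  have hshift : ∑ c : Fin 4, g (c + 1) = ∑ c, g c := Equiv.sum_comp (Equiv.addRight (1 : Fin 4)) g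
  rw [Fintype.sum_prod_type]
  simp only [Fintype.sum_bool, src, dst, if_true, if_false, Bool.false_eq_true]
  have : ∑ c : Fin 4, (g c + g (c + 1) + (g (c + 1) + g c)) = 2 * ∑ c, g c + 2 * ∑ c, g (c + 1) := by
    rw [Finset.mul_sum, Finset.mul_sum, ← Finset.sum_add_distrib]
    exact Finset.sum_congr rfl fun c _ => by ring
  rw [this, hshift]; ring

/-- `Σ_i [E (src i) ≠ E (dst i)] w = w · mixed E`. [folklore] -/
theorem sum_ite_mixed (E : Fin 4 → Bool) (w : ℝ) :
    ∑ i : Fin 4 × Bool, (if E (src i) ≠ E (dst i) then w else 0) = w * (mixed E : ℝ) := by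
  rw [← Finset.sum_filter, Finset.sum_const, nsmul_eq_mul, mixed, mul_comm]

/-- `Σ_c [E c] = cnt E`. [folklore] -/
theorem sum_ite_cnt (E : Fin 4 → Bool) :
    ∑ c : Fin 4, (if E c = true then (1 : ℝ) else 0) = (cnt E : ℝ) := by
  rw [← Finset.sum_filter, Finset.sum_const, nsmul_eq_mul, mul_one, cnt]

end Pattern

end Summit.HubbardSuperconductivity.HubbardSuperconductivity.Theorems.PlaquetteMottFloor
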